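import Literature.Barriers.SmoothPoincare4.ExoticContractibleTheoremAProofs
import Literature.Topology.FourManifolds.LickorishWallaceTwistSurgery
import HarnessLib

/-!
# The Claim of Akbulut–Ruberman's Thm. A from generators of the mapping class group (proved)

Sibling proof file of `Literature/Barriers/SmoothPoincare4/ExoticContractibleTheoremAProofs.lean`
(provefact seat of the named fact
`Literature.Barriers.SmoothPoincare4.akbulutRuberman2016_symmetryKillingCobordism`, S. Akbulut,
D. Ruberman, *Absolutely exotic compact 4-manifolds*, Comment. Math. Helv. 91 (2016) 1–19 =
arXiv:1410.1461v3, §3). Everything here is PROVED; no definitions, no named facts.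

## The printed step

The extension property (ii) of that fact is the tree's `FarEndDiffeosExtend X` (every
self-diffeomorphism of the far end `N` of the cobordism `X` extends over `X` up to isotopy, as a
diffeomorphism isotopic to the identity on the near end `M`), rendering the **Claim** of §3:
"The group of diffeomorphisms of `N` mod isotopy is isomorphic to `⊕ⁿ (ℤ ⊕ ℤ)`, and every
element extends over the cobordism `X` in such a way that it is isotopic to the identity on `M`."
Its printed proof has a 3-dimensional half — JSJ decomposition of `N`, triviality of the symmetry
groups of the hyperbolic pieces and Waldhausen's theorem give GENERATORS of `π₀ Diff(N)`: "It
follows trivially that the isotopy classes of diffeomorphisms of `𝕋 × [0,1]` that preserve the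
components, relative to the boundary is a sum of copies of `ℤ ⊕ ℤ`, with generators as described"
(the Dehn twists `(z, w, t) ↦ (e^{2πiat} z, e^{2πibt} w, t)`) — and a formal half: "Any such
generator extends in a natural way over `S¹ × D²`. It is easy to see that the extension, as a
diffeomorphism of `S¹ × D²`, is isotopic to the identity, via an isotopy that is the identity on
the boundary", i.e. each GENERATOR extends over `X` inducing on `M` a diffeomorphism isotopic to
the identity, and this suffices for every mapping class because extensions compose and invert.

This file proves the last implication once and for all, for an arbitrary cobordism `X` of
dimension `3 + 1` and an arbitrary set `S` of self-diffeomorphisms of its far end: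

* `Literature.Barriers.SmoothPoincare4.farEndDiffeosExtend_of_generators` — if every `s ∈ S`
  extends over `X` ON THE NOSE (`G ∘ inr = inr ∘ s`) with near-end restriction `k`
  (`G ∘ inl = inl ∘ k`) isotopic to `id_M`, and every self-diffeomorphism `g` of `N` is isotopic
  to a product (`Literature.Topology.FourManifolds.Diffeomorph.listProd`, the tree's spelling of
  "isotopic to the product of a sequence of …", cf. the Dehn–Lickorish fact
  `exists_isDehnTwist_isIsotopic_listProd`) of elements of `S` and their inverses, then
  `FarEndDiffeosExtend X`.
* `Literature.Barriers.SmoothPoincare4.farEndDiffeosExtend_of_generators_closure` — the same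
  with "generated up to isotopy" in list-free closure form (every isotopy-saturated collection of
  self-diffeomorphisms of `N` containing `S` and closed under identity, composition and inverse
  is everything).
* The algebra behind it: on-the-nose extensions with near end isotopic to the identity are
  closed under identity, inverse, composition and products of lists
  (`exists_extension_refl`, `exists_extension_symm`, `exists_extension_trans`,
  `exists_extension_listProd`), using three one-line facts of isotopy algebra proved here for
  any `C^∞` manifold (`isIsotopic_trans_right`: `φ ≃ ψ ⇒ φ ≫ χ ≃ ψ ≫ χ`, stagewise
  postcomposition, the embedding property of the stages by the tree's
  `Manifold.IsSmoothEmbedding.diffeomorph_comp`; `isIsotopic_refl_symm`: `k ≃ id ⇒ k⁻¹ ≃ id`;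
  `isIsotopic_refl_trans`: `k₁ ≃ id ∧ k₂ ≃ id ⇒ k₁ ≫ k₂ ≃ id`, by the tree's
  `Diffeomorph.IsIsotopic.trans_holds`).

What this isolates. With `akbulutRuberman2016_symmetryKillingCobordism_of_homologyCobordism`
(`ExoticContractibleSymmetryKillingCore.lean`) the named fact is reduced to the outputs of
Lemma 2.3 and of the Claim; with the present file the Claim's output `FarEndDiffeosExtend X` is in
turn reduced to (a) a generating set `S` of `π₀ Diff(N)` (the 3-manifold input: JSJ, trivial
symmetry groups of the hyperbolic pieces `M - L` and `S³ - ν(J)`, Waldhausen — no vocabulary in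
Mathlib or the tree) and (b) the on-the-nose extension of each generator with near end isotopic
to `id_M` (for the printed Dehn twists: the product extension over `𝕋 × [0,1] × I ⊂ X` and the
explicit isotopy `F_s` of §3 inside a solid torus neighbourhood of `L ⊂ M`). No new named fact is
introduced (D-0026).

## References

* S. Akbulut, D. Ruberman, *Absolutely exotic compact 4-manifolds*, Comment. Math. Helv. 91
  (2016) 1–19 = arXiv:1410.1461v3, §3, proof of Thm. A, Claim and its proof. [AkbulutRuberman2016]
* M. W. Hirsch, *Differential Topology*, Springer GTM 33 (1976), Ch. 8 §1 (isotopy algebra).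
  [HirschDT1976]
-/

noncomputable section

open scoped Manifold ContDiff
open Function Set
open Literature.Topology.FourManifolds

namespace Literature.Barriers.SmoothPoincare4

universe u

/-! ### Isotopy algebra: postcomposition, inverses and composites of diffeomorphisms isotopic to the identity -/

section IsotopyAlgebra

variable {E H : Type*} [NormedAddCommGroup E] [NormedSpace ℝ E] [TopologicalSpace H]
  {J : ModelWithCorners ℝ E H} {P : Type*} [TopologicalSpace P] [ChartedSpace H P]
  [IsManifold J ∞ P]

/-- **Isotopy is compatible with postcomposition**: if `φ ≃ ψ` then `φ ≫ χ ≃ ψ ≫ χ` (compose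
the isotopy stagewise with the diffeomorphism `χ`; the stages stay smooth embeddings by
`Manifold.IsSmoothEmbedding.diffeomorph_comp`). Companion of the tree's
`Diffeomorph.IsIsotopic.trans_left` (precomposition). Hirsch (1976), Ch. 8 §1.
[cite: HirschDT1976, Ch. 8 §1] -/
theorem isIsotopic_trans_right {φ ψ : P ≃ₘ⟮J, J⟯ P} (h : Diffeomorph.IsIsotopic φ ψ)
    (χ : P ≃ₘ⟮J, J⟯ P) : Diffeomorph.IsIsotopic (φ.trans χ) (ψ.trans χ) := by
  obtain ⟨F⟩ := h
  refine ⟨⟨fun t => χ ∘ F.toFun t, ?_, fun t => (F.isSmoothEmbedding t).diffeomorph_comp χ,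
    ?_, ?_⟩⟩
  · exact χ.contMDiff.comp F.contMDiff
  · funext x
    simp [F.map_zero, Diffeomorph.coe_trans]
  · funext x
    simp [F.map_one, Diffeomorph.coe_trans]

/-- **The inverse of a diffeomorphism isotopic to the identity is isotopic to the identity**:
postcompose `k ≃ id` with `k⁻¹`. Hirsch (1976), Ch. 8 §1. [cite: HirschDT1976, Ch. 8 §1] -/
theorem isIsotopic_refl_symm {k : P ≃ₘ⟮J, J⟯ P}
    (h : Diffeomorph.IsIsotopic k (Diffeomorph.refl J P ∞)) :
    Diffeomorph.IsIsotopic k.symm (Diffeomorph.refl J P ∞) := by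
  have h1 := isIsotopic_trans_right h k.symm
  rw [Diffeomorph.self_trans_symm, Diffeomorph.refl_trans] at h1
  exact h1.symm

/-- **A composite of diffeomorphisms isotopic to the identity is isotopic to the identity**:
postcompose `k₁ ≃ id` with `k₂` and use transitivity (`Diffeomorph.IsIsotopic.trans_holds`).
Hirsch (1976), Ch. 8 §1. [cite: HirschDT1976, Ch. 8 §1] -/
theorem isIsotopic_refl_trans {k₁ k₂ : P ≃ₘ⟮J, J⟯ P}
    (h₁ : Diffeomorph.IsIsotopic k₁ (Diffeomorph.refl J P ∞))
    (h₂ : Diffeomorph.IsIsotopic k₂ (Diffeomorph.refl J P ∞)) :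
    Diffeomorph.IsIsotopic (k₁.trans k₂) (Diffeomorph.refl J P ∞) := by
  have h := isIsotopic_trans_right h₁ k₂
  rw [Diffeomorph.refl_trans] at h
  exact Diffeomorph.IsIsotopic.trans_holds h h₂

end IsotopyAlgebra

/-! ### On-the-nose extensions over a cobordism compose and invert -/

section Extensions

variable {M N : Type u} [TopologicalSpace M] [ChartedSpace (EuclideanSpace ℝ (Fin 3)) M] [IsManifold (𝓡 3) ∞ M]
  [TopologicalSpace N] [ChartedSpace (EuclideanSpace ℝ (Fin 3)) N]

/-- The identity of `N` extends over `X` on the nose (by the identity of `X`, near end the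
identity of `M`). [folklore] -/
theorem exists_extension_refl (X : Cobordism 3 M N) :
    ∃ (G : X.W ≃ₘ⟮𝓡∂ 4, 𝓡∂ 4⟯ X.W) (k : M ≃ₘ⟮𝓡 3, 𝓡 3⟯ M),
      (∀ y, G (X.inr y) = X.inr (Diffeomorph.refl (𝓡 3) N ∞ y)) ∧
      (∀ x, G (X.inl x) = X.inl (k x)) ∧
      Diffeomorph.IsIsotopic k (Diffeomorph.refl (𝓡 3) M ∞) :=
  ⟨Diffeomorph.refl (𝓡∂ 4) X.W ∞, Diffeomorph.refl (𝓡 3) M ∞, fun _ => rfl, fun _ => rfl,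
    Diffeomorph.IsIsotopic.refl_holds _⟩

/-- **Inverses.** If `g` extends over `X` on the nose by `G` with near end `k ≃ id_M`, then
`g⁻¹` extends by `G⁻¹` with near end `k⁻¹ ≃ id_M` (`isIsotopic_refl_symm`). [folklore] -/
theorem exists_extension_symm (X : Cobordism 3 M N) {g : N ≃ₘ⟮𝓡 3, 𝓡 3⟯ N}
    (h : ∃ (G : X.W ≃ₘ⟮𝓡∂ 4, 𝓡∂ 4⟯ X.W) (k : M ≃ₘ⟮𝓡 3, 𝓡 3⟯ M),
      (∀ y, G (X.inr y) = X.inr (g y)) ∧ (∀ x, G (X.inl x) = X.inl (k x)) ∧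
      Diffeomorph.IsIsotopic k (Diffeomorph.refl (𝓡 3) M ∞)) :
    ∃ (G : X.W ≃ₘ⟮𝓡∂ 4, 𝓡∂ 4⟯ X.W) (k : M ≃ₘ⟮𝓡 3, 𝓡 3⟯ M),
      (∀ y, G (X.inr y) = X.inr (g.symm y)) ∧ (∀ x, G (X.inl x) = X.inl (k x)) ∧
      Diffeomorph.IsIsotopic k (Diffeomorph.refl (𝓡 3) M ∞) := by
  obtain ⟨G, k, hN, hM, hk⟩ := h
  refine ⟨G.symm, k.symm, fun y => ?_, fun x => ?_, isIsotopic_refl_symm hk⟩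
  · have h := hN (g.symm y)
    rw [Diffeomorph.apply_symm_apply] at h
    rw [← h, Diffeomorph.symm_apply_apply]
  · have h := hM (k.symm x)
    rw [Diffeomorph.apply_symm_apply] at h
    rw [← h, Diffeomorph.symm_apply_apply]

/-- **Composites.** If `g₁`, `g₂` extend over `X` on the nose by `G₁`, `G₂` with near ends
`k₁, k₂ ≃ id_M`, then `g₁ ≫ g₂` extends by `G₁ ≫ G₂` with near end `k₁ ≫ k₂ ≃ id_M`
(`isIsotopic_refl_trans`). [folklore] -/
theorem exists_extension_trans (X : Cobordism 3 M N) {g₁ g₂ : N ≃ₘ⟮𝓡 3, 𝓡 3⟯ N}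
    (h₁ : ∃ (G : X.W ≃ₘ⟮𝓡∂ 4, 𝓡∂ 4⟯ X.W) (k : M ≃ₘ⟮𝓡 3, 𝓡 3⟯ M),
      (∀ y, G (X.inr y) = X.inr (g₁ y)) ∧ (∀ x, G (X.inl x) = X.inl (k x)) ∧
      Diffeomorph.IsIsotopic k (Diffeomorph.refl (𝓡 3) M ∞))
    (h₂ : ∃ (G : X.W ≃ₘ⟮𝓡∂ 4, 𝓡∂ 4⟯ X.W) (k : M ≃ₘ⟮𝓡 3, 𝓡 3⟯ M),
      (∀ y, G (X.inr y) = X.inr (g₂ y)) ∧ (∀ x, G (X.inl x) = X.inl (k x)) ∧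
      Diffeomorph.IsIsotopic k (Diffeomorph.refl (𝓡 3) M ∞)) :
    ∃ (G : X.W ≃ₘ⟮𝓡∂ 4, 𝓡∂ 4⟯ X.W) (k : M ≃ₘ⟮𝓡 3, 𝓡 3⟯ M),
      (∀ y, G (X.inr y) = X.inr ((g₁.trans g₂) y)) ∧ (∀ x, G (X.inl x) = X.inl (k x)) ∧
      Diffeomorph.IsIsotopic k (Diffeomorph.refl (𝓡 3) M ∞) := by
  obtain ⟨G₁, k₁, hN₁, hM₁, hk₁⟩ := h₁
  obtain ⟨G₂, k₂, hN₂, hM₂, hk₂⟩ := h₂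
  refine ⟨G₁.trans G₂, k₁.trans k₂, fun y => ?_, fun x => ?_, isIsotopic_refl_trans hk₁ hk₂⟩
  · rw [Diffeomorph.coe_trans, comp_apply, hN₁, hN₂, Diffeomorph.coe_trans, comp_apply]
  · rw [Diffeomorph.coe_trans, comp_apply, hM₁, hM₂, Diffeomorph.coe_trans, comp_apply]

/-- **Products of generators and their inverses.** If every `s ∈ S` extends over `X` on the
nose with near end isotopic to `id_M`, then so does the product
(`Literature.Topology.FourManifolds.Diffeomorph.listProd`) of every list of elements of `S` and
inverses of elements of `S` (induction on the list: `exists_extension_refl`,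
`exists_extension_symm`, `exists_extension_trans`). [folklore] -/
theorem exists_extension_listProd (X : Cobordism 3 M N) (S : Set (N ≃ₘ⟮𝓡 3, 𝓡 3⟯ N))
    (hS : ∀ s ∈ S, ∃ (G : X.W ≃ₘ⟮𝓡∂ 4, 𝓡∂ 4⟯ X.W) (k : M ≃ₘ⟮𝓡 3, 𝓡 3⟯ M),
      (∀ y, G (X.inr y) = X.inr (s y)) ∧ (∀ x, G (X.inl x) = X.inl (k x)) ∧
      Diffeomorph.IsIsotopic k (Diffeomorph.refl (𝓡 3) M ∞))
    (l : List (N ≃ₘ⟮𝓡 3, 𝓡 3⟯ N)) (hl : ∀ s ∈ l, s ∈ S ∨ s.symm ∈ S) :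
    ∃ (G : X.W ≃ₘ⟮𝓡∂ 4, 𝓡∂ 4⟯ X.W) (k : M ≃ₘ⟮𝓡 3, 𝓡 3⟯ M),
      (∀ y, G (X.inr y) = X.inr (Diffeomorph.listProd l y)) ∧
      (∀ x, G (X.inl x) = X.inl (k x)) ∧
      Diffeomorph.IsIsotopic k (Diffeomorph.refl (𝓡 3) M ∞) := by
  induction l with
  | nil => simpa only [Diffeomorph.listProd_nil] using exists_extension_refl X
  | cons s l ih =>
    have hs : ∃ (G : X.W ≃ₘ⟮𝓡∂ 4, 𝓡∂ 4⟯ X.W) (k : M ≃ₘ⟮𝓡 3, 𝓡 3⟯ M),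
        (∀ y, G (X.inr y) = X.inr (s y)) ∧ (∀ x, G (X.inl x) = X.inl (k x)) ∧
        Diffeomorph.IsIsotopic k (Diffeomorph.refl (𝓡 3) M ∞) := by
      rcases hl s List.mem_cons_self with h | h
      · exact hS s h
      · -- `s = (s⁻¹)⁻¹` definitionally
        obtain ⟨G, k, hN, hM, hk⟩ := exists_extension_symm X (hS s.symm h)
        exact ⟨G, k, fun y => hN y, hM, hk⟩
    have hl' : ∀ s' ∈ l, s' ∈ S ∨ s'.symm ∈ S := fun s' hs' => hl s' (List.mem_cons_of_mem s hs')
    simpa only [Diffeomorph.listProd_cons] using exists_extension_trans X hs (ih hl')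

end Extensions

/-! ### The Claim from generators -/

section Claim

variable {M N : Type u} [TopologicalSpace M] [ChartedSpace (EuclideanSpace ℝ (Fin 3)) M] [IsManifold (𝓡 3) ∞ M]
  [TopologicalSpace N] [ChartedSpace (EuclideanSpace ℝ (Fin 3)) N]

/-- **The extension property of the Claim from generators of `π₀ Diff(N)`** (Akbulut–Ruberman
2016, §3, proof of the Claim: "… with generators as described. Any such generator extends in a
natural way … isotopic to the identity, via an isotopy that is the identity on the boundary").
Let `X` be a cobordism from `M` to `N` (dimension `3 + 1`) and `S` a set of self-diffeomorphisms
of `N` such that (a) every self-diffeomorphism `g` of `N` is isotopic to the product of a list of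
elements of `S` and inverses of elements of `S` (`S` generates the diffeomorphisms of `N` up to
isotopy), and (b) every `s ∈ S` extends over `X` on the nose, `G ∘ inr = inr ∘ s`, with near-end
restriction `k` (`G ∘ inl = inl ∘ k`) isotopic to the identity of `M`. Then `X` has the
extension property of the Claim, `FarEndDiffeosExtend X`: given `g`, the product `g′` of the list
extends on the nose (`exists_extension_listProd`) and is isotopic to `g`.
[cite: AkbulutRuberman2016, §3, proof of Thm. A, Claim and its proof] -/
theorem farEndDiffeosExtend_of_generators (X : Cobordism 3 M N) (S : Set (N ≃ₘ⟮𝓡 3, 𝓡 3⟯ N))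
    (hS : ∀ s ∈ S, ∃ (G : X.W ≃ₘ⟮𝓡∂ 4, 𝓡∂ 4⟯ X.W) (k : M ≃ₘ⟮𝓡 3, 𝓡 3⟯ M),
      (∀ y, G (X.inr y) = X.inr (s y)) ∧ (∀ x, G (X.inl x) = X.inl (k x)) ∧
      Diffeomorph.IsIsotopic k (Diffeomorph.refl (𝓡 3) M ∞))
    (hgen : ∀ g : N ≃ₘ⟮𝓡 3, 𝓡 3⟯ N, ∃ l : List (N ≃ₘ⟮𝓡 3, 𝓡 3⟯ N),
      (∀ s ∈ l, s ∈ S ∨ s.symm ∈ S) ∧ Diffeomorph.IsIsotopic (Diffeomorph.listProd l) g) :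
    FarEndDiffeosExtend X := by
  intro g
  obtain ⟨l, hl, hiso⟩ := hgen g
  obtain ⟨G, k, hN, hM, hk⟩ := exists_extension_listProd X S hS l hl
  exact ⟨G, Diffeomorph.listProd l, k, hN, hM, hiso, hk⟩

/-- **The extension property of the Claim from generators, closure form.** The same with
hypothesis (a) stated without lists: every collection `T` of self-diffeomorphisms of `N` which
contains `S` and the identity, is closed under composition and inverse, and is saturated under
isotopy, is all of `Diff(N)`. (The collection of `g` admitting an on-the-nose extension with near
end isotopic to `id_M`, up to isotopy of `g`, is such a `T`.)
[cite: AkbulutRuberman2016, §3, proof of Thm. A, Claim and its proof] -/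
theorem farEndDiffeosExtend_of_generators_closure [IsManifold (𝓡 3) ∞ N] (X : Cobordism 3 M N)
    (S : Set (N ≃ₘ⟮𝓡 3, 𝓡 3⟯ N))
    (hS : ∀ s ∈ S, ∃ (G : X.W ≃ₘ⟮𝓡∂ 4, 𝓡∂ 4⟯ X.W) (k : M ≃ₘ⟮𝓡 3, 𝓡 3⟯ M),
      (∀ y, G (X.inr y) = X.inr (s y)) ∧ (∀ x, G (X.inl x) = X.inl (k x)) ∧
      Diffeomorph.IsIsotopic k (Diffeomorph.refl (𝓡 3) M ∞))
    (hgen : ∀ T : Set (N ≃ₘ⟮𝓡 3, 𝓡 3⟯ N), S ⊆ T → Diffeomorph.refl (𝓡 3) N ∞ ∈ T →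
      (∀ g₁ ∈ T, ∀ g₂ ∈ T, g₁.trans g₂ ∈ T) → (∀ g ∈ T, g.symm ∈ T) →
      (∀ g ∈ T, ∀ g', Diffeomorph.IsIsotopic g g' → g' ∈ T) → ∀ g, g ∈ T) :
    FarEndDiffeosExtend X := by
  -- `T` = the diffeomorphisms isotopic to one that extends on the nose with near end `≃ id_M`.
  let T : Set (N ≃ₘ⟮𝓡 3, 𝓡 3⟯ N) := {g | ∃ (g' : N ≃ₘ⟮𝓡 3, 𝓡 3⟯ N)
    (G : X.W ≃ₘ⟮𝓡∂ 4, 𝓡∂ 4⟯ X.W) (k : M ≃ₘ⟮𝓡 3, 𝓡 3⟯ M),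
      (∀ y, G (X.inr y) = X.inr (g' y)) ∧ (∀ x, G (X.inl x) = X.inl (k x)) ∧
      Diffeomorph.IsIsotopic g' g ∧ Diffeomorph.IsIsotopic k (Diffeomorph.refl (𝓡 3) M ∞)}
  -- membership in `T` from an on-the-nose extension of `g` itself
  have hT_of_nose : ∀ g : N ≃ₘ⟮𝓡 3, 𝓡 3⟯ N, (∃ (G : X.W ≃ₘ⟮𝓡∂ 4, 𝓡∂ 4⟯ X.W)
      (k : M ≃ₘ⟮𝓡 3, 𝓡 3⟯ M), (∀ y, G (X.inr y) = X.inr (g y)) ∧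
        (∀ x, G (X.inl x) = X.inl (k x)) ∧
        Diffeomorph.IsIsotopic k (Diffeomorph.refl (𝓡 3) M ∞)) → g ∈ T := by
    rintro g ⟨G, k, hN, hM, hk⟩
    exact ⟨g, G, k, hN, hM, Diffeomorph.IsIsotopic.refl_holds g, hk⟩
  have hall : ∀ g, g ∈ T := by
    refine hgen T (fun s hs => hT_of_nose s (hS s hs)) (hT_of_nose _ (exists_extension_refl X))
      ?_ ?_ ?_
    · rintro g₁ ⟨g₁', G₁, k₁, hN₁, hM₁, hg₁, hk₁⟩ g₂ ⟨g₂', G₂, k₂, hN₂, hM₂, hg₂, hk₂⟩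
      obtain ⟨G, k, hN, hM, hk⟩ :=
        exists_extension_trans X ⟨G₁, k₁, hN₁, hM₁, hk₁⟩ ⟨G₂, k₂, hN₂, hM₂, hk₂⟩
      refine ⟨g₁'.trans g₂', G, k, hN, hM, ?_, hk⟩
      -- `g₁' ≫ g₂' ≃ g₁ ≫ g₂' ≃ g₁ ≫ g₂`
      exact Diffeomorph.IsIsotopic.trans_holds (isIsotopic_trans_right hg₁ g₂')
        (Diffeomorph.IsIsotopic.trans_left g₁ hg₂)
    · rintro g ⟨g', G, k, hN, hM, hg, hk⟩
      obtain ⟨G', k', hN', hM', hk'⟩ := exists_extension_symm X ⟨G, k, hN, hM, hk⟩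
      refine ⟨g'.symm, G', k', hN', hM', ?_, hk'⟩
      -- `g'⁻¹ ≃ g⁻¹`: from `g' ≃ g`, `id = g'⁻¹ ≫ g' ≃ g'⁻¹ ≫ g`, then `g⁻¹ ≃ g'⁻¹ ≫ g ≫ g⁻¹ = g'⁻¹`
      have h1 : Diffeomorph.IsIsotopic (Diffeomorph.refl (𝓡 3) N ∞) (g'.symm.trans g) := by
        simpa only [Diffeomorph.symm_trans_self] using Diffeomorph.IsIsotopic.trans_left g'.symm hg
      have h2 := isIsotopic_trans_right h1 g.symm
      have e2 : (g'.symm.trans g).trans g.symm = g'.symm := Diffeomorph.ext fun x => by simp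
      rw [Diffeomorph.refl_trans, e2] at h2
      exact h2.symm
    · rintro g ⟨g', G, k, hN, hM, hg, hk⟩ g'' hgg''
      exact ⟨g', G, k, hN, hM, Diffeomorph.IsIsotopic.trans_holds hg hgg'', hk⟩
  intro g
  obtain ⟨g', G, k, hN, hM, hg, hk⟩ := hall g
  exact ⟨G, g', k, hN, hM, hg, hk⟩

end Claim

end Literature.Barriers.SmoothPoincare4

end
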